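import Summits.QuantumFields.BalabanUV.Beta.FP.KernelPeriodisationFibHessKer

/-!
# `BalabanUV.Beta.FP.KernelPeriodisationFibTraceTwoLegs` — road «FP» (binder row D1), ROUTE T, (T-PER) PART 4⁵ = **(P2⁵): THE TWO-LEG BUBBLE** — the
# two-insertion torus word `perF A · perF (dper U) · perF B · perF (dper V)` through TWO (possibly different) `Mℤ`-invariant decaying legs `A`, `B`
# is ONE periodised word `perF (dper (((A⋆U)⋆B) ⋆ dper V))`, its trace is within `C″·e^{−(ε∕4)N}` of the lattice value `tr (((A⋆U)⋆B)⋆V)` and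
# converges to it along growing boxes; hence the order-2 TADPOLE of a RESOLVENT-DRESSED second jet (R-FP-58's total jet: a word QUADRATIC in the
# tables, `U · K · V` on the lattice, `perF (dper U) · perF K · perF (dper V)` on the torus) converges to the lattice tadpole `tr (A ⋆ ((U⋆K)⋆V))`

WHY (NOTE N-1 [D1LEAF06-G23-N1] (iii)).  (P2″) F2 §3 ∕ (P2‴) typed the bubble with ONE leg `A` in both slots — the shape of `hessT L V V′ W`'s
`tr (L·V·(L·V′))`.  R-FP-58 (HOME/CLAIMS.log l.46427) makes the door's order-2 slot the TOTAL second jet, which contains words QUADRATIC in the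
first-order tables read through the resolvent `K` (`SecondOrderResponse.K2OfK`'s second response `dM (K2OfK K N S M ·) N S M`, `mixOfK`); on the
torus such a word is a TWO-INSERTION word, not `perF ∘ dper` of a fixed lattice kernel (the two differ by the wrap-around copies —
`KernelPeriodisationFibTraceTwo.trace_perF_dper_comp_dper`'s `j ≠ 0` terms), and its tadpole against the door's leg `A` is the two-leg bubble of
this file with `B := K`.  The proofs are (P2″) F2 §3's with the second leg renamed; nothing of F2 is restated (its one-leg theorems are the case
`B := A`, kept as they are).
CONTENT ([folklore]; no `def`, no `def … : Prop`, nothing cited, 0 sorry; 0 estimates beyond (P2″)'s displayed constants):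
§1 `biLoc_bubbleWord₂` (`(A⋆U)⋆B` bi-localised at `U`'s points), **`perF_bubble_word₂`**, `trace_bubble₂_eq_tsum`, **`abs_trace_bubble₂_sub_tr_le`**,
**`tendsto_trace_bubble₂`**; §2 `comp_bubbleWord₂_assoc` (`((A⋆U)⋆B)⋆V = (A⋆U)⋆(B⋆V)`), `comp_leg_bubbleWord₂_assoc` (`A ⋆ ((U⋆B)⋆V) = ((A⋆U)⋆B)⋆V`),
**`tendsto_trace_tadpole₂`** (the order-2 tadpole of a two-insertion jet: `trace (perF A · (perF (dper U) · perF B · perF (dper V))) → tadpole A ((U⋆B)⋆V)`),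
**`tendsto_two_mul_hessT_perF₂`** (`2·hessT` with the tadpole slot a two-insertion word and the bubble as in (P2‴): `→ tadpole A ((U′⋆B)⋆V′) − bubble A U V`).
What it is NOT: not the image-sum collapse for genuine bi-tables (NOTE N-1 (ii) — finite range ∕ relative decay; separate letter on the OWNER's word),
not the (J-a) naming of WHICH words occur.  Moves NO (CONV-C) clause and NO row-D1 binder; NOT (T-ID), NOT SDF, NOT D1, NOT BetaPertH, NOT continuum,
NOT Clay.

HONEST DEPENDENCY (page 1, mandatory): continuum YM on T⁴ ⇐ BetaPertH ∧ nine spine estimates (0/9 proved); BetaPertH ⇐ (D1) ∧ (D4) ∧ CAP+tail;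
G-an2-4 gates asym, D1 and NE2/3/4.  HONEST FRAMING (cell contract, verbatim): «discharging `BetaPertH` makes Bałaban's UV stability UNCONDITIONAL —
a real constructive-QFT result; it is NOT the continuum limit and NOT the Clay problem.»  ABSOLUTE RULE (cell charter, verbatim): «No internally-minted
statement may enter as a cited fact. Every hypothesis is either kernel-proved in this package or a verbatim quotation of a PUBLISHED theorem with page
reference. The manuscript(s) under audit are NOT citable for their own disputed steps — they are the thing under adjudication; programme-internal
(2001/route/tribunal) claims are never citable.»  Nothing of Bałaban's asserted.  D1 formalisation swarm LEAF PROVER 06 (b2b-balaban-beta-d1-formalise-leaf-06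
gen 23), 2026-08-22.  No existing file touched.
-/

noncomputable section

open scoped BigOperators Matrix Topology
open Finset Filter

namespace Summit.QuantumFields.BalabanUV.Beta.FP.KernelPeriodisationFibTraceTwoLegs

open Literature.MathematicalPhysics.QuantumFieldTheory.Balaban1983to89
open Literature.MathematicalPhysics.QuantumFieldTheory.Balaban1983to89.Beta
open B12Sec2to5 (l1)
open B4TorusKernel.MultiPeriod (translate)
open B4Sect5Proof (latticeConst)
open ExpKernelCalculus (MKer Decays BiLoc tr bubble tadpole Zl Zl_nonneg)
open OneStepResolventKernel (biLoc_mono decays_mono)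
open BalabanStepJetsSucc (biLoc_comp_right)
open KernelWard (comp_assoc_bdb comp_assoc_dbb)
open Summit.QuantumFields.BalabanUV.Beta.D1BFx.MixedVarPackedHess (hessT two_mul_hessT)
open Summit.QuantumFields.BalabanUV.Beta.FP.KernelPeriodisationFib (perF perF_comp)
open Summit.QuantumFields.BalabanUV.Beta.FP.KernelPeriodisationFibLoc (dper dper_translate decays_dper comp_dper_left comp_dper_right)
open Summit.QuantumFields.BalabanUV.Beta.FP.KernelPeriodisationFibTrace (trSh)
open Summit.QuantumFields.BalabanUV.Beta.FP.KernelPeriodisationFibTraceTwo (trace_perF_dper_comp_dper)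
open Summit.QuantumFields.BalabanUV.Beta.FP.KernelPeriodisationFibTraceTwoBound (biLoc_leg_comp abs_trace_perF_dper_comp_dper_sub_tr_le
  tendsto_trace_perF_dper_comp_dper)
open Summit.QuantumFields.BalabanUV.Beta.FP.KernelPeriodisationFibHessKer (tendsto_trace_bubble')

variable {d : ℕ} {F : Type*} [Fintype F]

/-! ## §1 The two-leg bubble word, its wrap-around and its limit -/

section Bubble2

variable (M : Fin (d + 1) → ℕ) [∀ μ, NeZero (M μ)]
variable {A B U V : MKer (d + 1) F} {CA CB CU CV α β δU δV : ℝ} {p q p' q' : Fin (d + 1) → ℤ}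

/-- [folklore] **THE TWO-LEG BUBBLE's LATTICE WORD `X := (A ⋆ U) ⋆ B` IS BI-LOCALISED** at `U`'s points `(p, q)`, rate `γ∕4`, `γ = min (min α β) δU`
((P2″)'s `biLoc_leg_comp` at the common leg rate `min α β`, then `biLoc_comp_right` through `B`). -/
theorem biLoc_bubbleWord₂ (hA : Decays A CA α) (hB : Decays B CB β) (hU : BiLoc U p q CU δU) (hCA : 0 ≤ CA) (hCB : 0 ≤ CB) (hCU : 0 ≤ CU)
    (hα : 0 < α) (hβ : 0 < β) (hδU : 0 < δU) :
    BiLoc (ExpKernelCalculus.comp (ExpKernelCalculus.comp A U) B) p q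
      ((Fintype.card F : ℝ) * (((Fintype.card F : ℝ) * (CA * CU) * Zl (d + 1) (min (min α β) δU - min (min α β) δU / 2)) * CB) *
        Zl (d + 1) (min (min α β) δU / 2 - min (min α β) δU / 4)) (min (min α β) δU / 4) := by
  have hγ : 0 < min (min α β) δU := lt_min (lt_min hα hβ) hδU
  have hA' : Decays A CA (min α β) := decays_mono hA hCA le_rfl (min_le_left α β)
  have h1 := biLoc_leg_comp hA' hU hCA hCU (lt_min hα hβ) hδU
  have hB2 : Decays B CB (min (min α β) δU / 2) :=
    decays_mono hB hCB le_rfl ((half_le_self hγ.le).trans ((min_le_left _ _).trans (min_le_right α β)))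
  exact biLoc_comp_right h1 hB2 (show 0 ≤ min (min α β) δU / 4 by positivity) (show min (min α β) δU / 4 < min (min α β) δU / 2 by linarith)

/-- [folklore] **THE TWO-LEG BUBBLE AS ONE PERIODISED WORD**: `perF A · perF (dper U) · perF B · perF (dper V) = perF (dper (((A⋆U)⋆B) ⋆ dper V))`
for `Mℤ`-invariant decaying legs `A`, `B` and bi-localised insertions `U`, `V` (`perF_comp` ×3 + `comp_dper_left ∕ _right`). -/
theorem perF_bubble_word₂ (hA : Decays A CA α) (hα : 0 < α) (hB : Decays B CB β) (hβ : 0 < β)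
    (hAinv : ∀ (m x y : Fin (d + 1) → ℤ) (a b : F), A (translate M x m) (translate M y m) a b = A x y a b)
    (hBinv : ∀ (m x y : Fin (d + 1) → ℤ) (a b : F), B (translate M x m) (translate M y m) a b = B x y a b)
    (hU : BiLoc U p q CU δU) (hCU : 0 ≤ CU) (hδU : 0 < δU) (hV : BiLoc V p' q' CV δV) (hCV : 0 ≤ CV) (hδV : 0 < δV)
    (hCA : 0 ≤ CA) (hCB : 0 ≤ CB) :
    perF M A * perF M (dper M U) * perF M B * perF M (dper M V) =
      perF M (dper M (ExpKernelCalculus.comp (ExpKernelCalculus.comp (ExpKernelCalculus.comp A U) B) (dper M V))) := by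
  have hγ : 0 < min (min α β) δU := lt_min (lt_min hα hβ) hδU
  have hinvU : ∀ (m x y : Fin (d + 1) → ℤ) (a b : F), dper M U (translate M x m) (translate M y m) a b = dper M U x y a b :=
    fun m x y a b => dper_translate M U m x y a b
  have hinvV : ∀ (m x y : Fin (d + 1) → ℤ) (a b : F), dper M V (translate M x m) (translate M y m) a b = dper M V x y a b :=
    fun m x y a b => dper_translate M V m x y a b
  have hA' : Decays A CA (min α β) := decays_mono hA hCA le_rfl (min_le_left α β)
  have hAU := biLoc_leg_comp hA' hU hCA hCU (lt_min hα hβ) hδU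
  have hX := biLoc_bubbleWord₂ hA hB hU hCA hCB hCU hα hβ hδU
  have hCAU : 0 ≤ (Fintype.card F : ℝ) * (CA * CU) * Zl (d + 1) (min (min α β) δU - min (min α β) δU / 2) :=
    mul_nonneg (by positivity) (Zl_nonneg (by linarith))
  have hCX : 0 ≤ (Fintype.card F : ℝ) * (((Fintype.card F : ℝ) * (CA * CU) * Zl (d + 1) (min (min α β) δU - min (min α β) δU / 2)) * CB) *
      Zl (d + 1) (min (min α β) δU / 2 - min (min α β) δU / 4) := mul_nonneg (by positivity) (Zl_nonneg (by linarith))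
  have hB2 : Decays B CB (min (min α β) δU / 2) :=
    decays_mono hB hCB le_rfl ((half_le_self hγ.le).trans ((min_le_left _ _).trans (min_le_right α β)))
  -- step 1: `A ⋆ dper U = dper (A ⋆ U)`;  step 2: `dper (A ⋆ U) ⋆ B = dper X`;  step 3: `dper X ⋆ dper V = dper (X ⋆ dper V)`
  have s1 : ExpKernelCalculus.comp A (dper M U) = dper M (ExpKernelCalculus.comp A U) := comp_dper_left M hA hα hAinv hU hδU
  have s2 : ExpKernelCalculus.comp (dper M (ExpKernelCalculus.comp A U)) B = dper M (ExpKernelCalculus.comp (ExpKernelCalculus.comp A U) B) :=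
    comp_dper_right M hAU (half_pos hγ) hB2 (half_pos hγ) hBinv
  have s3 : ExpKernelCalculus.comp (dper M (ExpKernelCalculus.comp (ExpKernelCalculus.comp A U) B)) (dper M V) =
      dper M (ExpKernelCalculus.comp (ExpKernelCalculus.comp (ExpKernelCalculus.comp A U) B) (dper M V)) :=
    comp_dper_right M hX (by positivity) (decays_dper M hV hCV hδV) (half_pos hδV) hinvV
  have e1 : perF M (ExpKernelCalculus.comp A (dper M U)) = perF M A * perF M (dper M U) :=
    perF_comp M hA (decays_dper M hU hCU hδU) hα (half_pos hδU) hinvU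
  have e2 : perF M (ExpKernelCalculus.comp (dper M (ExpKernelCalculus.comp A U)) B) = perF M (dper M (ExpKernelCalculus.comp A U)) * perF M B :=
    perF_comp M (decays_dper M hAU hCAU (half_pos hγ)) hB (half_pos (half_pos hγ)) hβ hBinv
  have e3 : perF M (ExpKernelCalculus.comp (dper M (ExpKernelCalculus.comp (ExpKernelCalculus.comp A U) B)) (dper M V)) =
      perF M (dper M (ExpKernelCalculus.comp (ExpKernelCalculus.comp A U) B)) * perF M (dper M V) :=
    perF_comp M (decays_dper M hX hCX (by positivity)) (decays_dper M hV hCV hδV) (by positivity) (half_pos hδV) hinvV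
  rw [← e1, s1, ← e2, s2, ← e3, s3]

/-- [folklore] **`trace_bubble₂_eq_tsum`**: `trace (perF A · perF (dper U) · perF B · perF (dper V)) = Σ'_j Σ'_m trSh M (((A⋆U)⋆B) ⋆ shiftK (M∘j) V) m`. -/
theorem trace_bubble₂_eq_tsum (hA : Decays A CA α) (hα : 0 < α) (hB : Decays B CB β) (hβ : 0 < β)
    (hAinv : ∀ (m x y : Fin (d + 1) → ℤ) (a b : F), A (translate M x m) (translate M y m) a b = A x y a b)
    (hBinv : ∀ (m x y : Fin (d + 1) → ℤ) (a b : F), B (translate M x m) (translate M y m) a b = B x y a b)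
    (hU : BiLoc U p q CU δU) (hδU : 0 < δU) (hV : BiLoc V p' q' CV δV) (hδV : 0 < δV) :
    Matrix.trace (perF M A * perF M (dper M U) * perF M B * perF M (dper M V)) =
      ∑' j : Fin (d + 1) → ℤ, ∑' m : Fin (d + 1) → ℤ,
        trSh M (ExpKernelCalculus.comp (ExpKernelCalculus.comp (ExpKernelCalculus.comp A U) B)
          (ExpKernelCalculus.shiftK (fun i => (M i : ℤ) * j i) V)) m := by
  rcases isEmpty_or_nonempty F with hF | ⟨⟨a₀⟩⟩
  · rw [Matrix.trace]; simp [Finset.univ_eq_empty, KernelPeriodisationFibTrace.trSh_apply, tsum_zero]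
  have hCA : 0 ≤ CA := hA.nonneg a₀
  have hCB : 0 ≤ CB := hB.nonneg a₀
  have hCU : 0 ≤ CU := hU.nonneg a₀
  have hCV : 0 ≤ CV := hV.nonneg a₀
  rw [perF_bubble_word₂ M hA hα hB hβ hAinv hBinv hU hCU hδU hV hCV hδV hCA hCB]
  exact trace_perF_dper_comp_dper M (biLoc_bubbleWord₂ hA hB hU hCA hCB hCU hα hβ hδU) hV
    (by have := lt_min (lt_min hα hβ) hδU; positivity) hδV

/-- [folklore] **`abs_trace_bubble₂_sub_tr_le` — THE TWO-LEG BUBBLE's WRAP-AROUND**: for periods `M_i ≥ N`,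
`|trace (perF A · perF (dper U) · perF B · perF (dper V)) − tr ((((A⋆U)⋆B)) ⋆ V)| ≤ C″·e^{−(ε∕4)N}`, `ε = min (γ∕4) δV`, `γ = min (min α β) δU`,
`C″` = (P2″) F2 §1's constant at the bi-localisation data of `X := (A⋆U)⋆B` (displayed). -/
theorem abs_trace_bubble₂_sub_tr_le (hA : Decays A CA α) (hα : 0 < α) (hB : Decays B CB β) (hβ : 0 < β)
    (hAinv : ∀ (m x y : Fin (d + 1) → ℤ) (a b : F), A (translate M x m) (translate M y m) a b = A x y a b)
    (hBinv : ∀ (m x y : Fin (d + 1) → ℤ) (a b : F), B (translate M x m) (translate M y m) a b = B x y a b)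
    (hU : BiLoc U p q CU δU) (hδU : 0 < δU) (hV : BiLoc V p' q' CV δV) (hδV : 0 < δV) {N : ℕ} (hMN : ∀ i, N ≤ M i) :
    |Matrix.trace (perF M A * perF M (dper M U) * perF M B * perF M (dper M V))
        - tr (ExpKernelCalculus.comp (ExpKernelCalculus.comp (ExpKernelCalculus.comp A U) B) V)| ≤
      (Fintype.card F : ℝ) * ((Fintype.card F : ℝ) *
          ((Fintype.card F : ℝ) * (((Fintype.card F : ℝ) * (CA * CU) * Zl (d + 1) (min (min α β) δU - min (min α β) δU / 2)) * CB) *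
            Zl (d + 1) (min (min α β) δU / 2 - min (min α β) δU / 4) * CV) * Zl (d + 1) (min (min (min α β) δU / 4) δV / 2)) *
        (Zl (d + 1) (min (min (min α β) δU / 4) δV / 2 / 2) * latticeConst (d + 1) (min (min (min α β) δU / 4) δV / 2 / 2)) *
        (Real.exp (-(min (min (min α β) δU / 4) δV / 2) * l1 (q - p')) * Real.exp (min (min (min α β) δU / 4) δV / 2 / 2 * l1 (p - q'))
          + Real.exp (min (min (min α β) δU / 4) δV / 4 * l1 (q - p')) * latticeConst (d + 1) (min (min (min α β) δU / 4) δV / 4)) *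
        Real.exp (-(min (min (min α β) δU / 4) δV / 4 * N)) := by
  rcases isEmpty_or_nonempty F with hF | ⟨⟨a₀⟩⟩
  · have h0 : Matrix.trace (perF M A * perF M (dper M U) * perF M B * perF M (dper M V)) = 0 := by
      rw [Matrix.trace]; simp [Finset.univ_eq_empty]
    have h1 : tr (ExpKernelCalculus.comp (ExpKernelCalculus.comp (ExpKernelCalculus.comp A U) B) V) = 0 := by
      simp only [ExpKernelCalculus.tr, Finset.univ_eq_empty, Finset.sum_empty, tsum_zero]
    rw [h0, h1, sub_zero, abs_zero, Fintype.card_eq_zero, Nat.cast_zero]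
    simp
  have hCA : 0 ≤ CA := hA.nonneg a₀
  have hCB : 0 ≤ CB := hB.nonneg a₀
  have hCU : 0 ≤ CU := hU.nonneg a₀
  have hCV : 0 ≤ CV := hV.nonneg a₀
  rw [perF_bubble_word₂ M hA hα hB hβ hAinv hBinv hU hCU hδU hV hCV hδV hCA hCB]
  exact abs_trace_perF_dper_comp_dper_sub_tr_le M (biLoc_bubbleWord₂ hA hB hU hCA hCB hCU hα hβ hδU) hV
    (by have := lt_min (lt_min hα hβ) hδU; positivity) hδV hMN

/-- [folklore] **`tendsto_trace_bubble₂` — the two-leg bubble read-out along growing boxes converges to the lattice word `tr (((A⋆U)⋆B)⋆V)`.** -/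
theorem tendsto_trace_bubble₂ (Mk : ℕ → (Fin (d + 1) → ℕ)) [∀ k μ, NeZero (Mk k μ)] (hMk : ∀ N : ℕ, ∀ᶠ k in atTop, ∀ i, N ≤ Mk k i)
    (hA : Decays A CA α) (hα : 0 < α) (hB : Decays B CB β) (hβ : 0 < β)
    (hAinv : ∀ k (m x y : Fin (d + 1) → ℤ) (a b : F), A (translate (Mk k) x m) (translate (Mk k) y m) a b = A x y a b)
    (hBinv : ∀ k (m x y : Fin (d + 1) → ℤ) (a b : F), B (translate (Mk k) x m) (translate (Mk k) y m) a b = B x y a b)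
    (hU : BiLoc U p q CU δU) (hδU : 0 < δU) (hV : BiLoc V p' q' CV δV) (hδV : 0 < δV) :
    Tendsto (fun k => Matrix.trace (perF (Mk k) A * perF (Mk k) (dper (Mk k) U) * perF (Mk k) B * perF (Mk k) (dper (Mk k) V))) atTop
      (𝓝 (tr (ExpKernelCalculus.comp (ExpKernelCalculus.comp (ExpKernelCalculus.comp A U) B) V))) := by
  rcases isEmpty_or_nonempty F with hF | ⟨⟨a₀⟩⟩
  · have h0 : ∀ k, Matrix.trace (perF (Mk k) A * perF (Mk k) (dper (Mk k) U) * perF (Mk k) B * perF (Mk k) (dper (Mk k) V)) = 0 :=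
      fun k => by rw [Matrix.trace]; simp [Finset.univ_eq_empty]
    have h1 : tr (ExpKernelCalculus.comp (ExpKernelCalculus.comp (ExpKernelCalculus.comp A U) B) V) = 0 := by
      simp only [ExpKernelCalculus.tr, Finset.univ_eq_empty, Finset.sum_empty, tsum_zero]
    simp only [h0, h1]
    exact tendsto_const_nhds
  have hCA : 0 ≤ CA := hA.nonneg a₀
  have hCB : 0 ≤ CB := hB.nonneg a₀
  have hCU : 0 ≤ CU := hU.nonneg a₀
  have hCV : 0 ≤ CV := hV.nonneg a₀
  have h := tendsto_trace_perF_dper_comp_dper Mk hMk (biLoc_bubbleWord₂ hA hB hU hCA hCB hCU hα hβ hδU) hV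
    (by have := lt_min (lt_min hα hβ) hδU; positivity) hδV
  refine h.congr fun k => ?_
  rw [perF_bubble_word₂ (Mk k) hA hα hB hβ (hAinv k) (hBinv k) hU hCU hδU hV hCV hδV hCA hCB]

end Bubble2

/-! ## §2 The order-2 TADPOLE of a two-insertion jet, and `2·hessT` with such a tadpole slot -/

section Tadpole2

variable {A B U V U' V' W : MKer (d + 1) F} {CA CB CU CV CU' CV' α β δU δV δU' δV' : ℝ} {p q p' q' r s r' s' : Fin (d + 1) → ℤ}

/-- [folklore] `((A ⋆ U) ⋆ B) ⋆ V = (A ⋆ U) ⋆ (B ⋆ V)` for decaying legs and bi-localised insertions (`KernelWard.comp_assoc_bdb` at the common rate). -/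
theorem comp_bubbleWord₂_assoc (hA : Decays A CA α) (hα : 0 < α) (hB : Decays B CB β) (hβ : 0 < β)
    (hU : BiLoc U p q CU δU) (hδU : 0 < δU) (hV : BiLoc V p' q' CV δV) (hδV : 0 < δV) :
    ExpKernelCalculus.comp (ExpKernelCalculus.comp (ExpKernelCalculus.comp A U) B) V =
      ExpKernelCalculus.comp (ExpKernelCalculus.comp A U) (ExpKernelCalculus.comp B V) := by
  rcases isEmpty_or_nonempty F with hF | ⟨⟨a₀⟩⟩
  · funext x z a b; exact (IsEmpty.false a).elim
  have hCA : 0 ≤ CA := hA.nonneg a₀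
  have hCB : 0 ≤ CB := hB.nonneg a₀
  have hCU : 0 ≤ CU := hU.nonneg a₀
  have hCV : 0 ≤ CV := hV.nonneg a₀
  have hαβ : 0 < min α β := lt_min hα hβ
  have hγ : 0 < min (min (min α β) δU / 2) δV := lt_min (half_pos (lt_min hαβ hδU)) hδV
  have hA' : Decays A CA (min α β) := decays_mono hA hCA le_rfl (min_le_left α β)
  have hAU := biLoc_leg_comp hA' hU hCA hCU hαβ hδU
  have hP : BiLoc (ExpKernelCalculus.comp A U) p q
      ((Fintype.card F : ℝ) * (CA * CU) * ExpKernelCalculus.Zl (d + 1) (min (min α β) δU - min (min α β) δU / 2))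
      (min (min (min α β) δU / 2) δV) :=
    biLoc_mono hAU (mul_nonneg (by positivity) (ExpKernelCalculus.Zl_nonneg (by linarith [lt_min hαβ hδU]))) (min_le_left _ _)
  have hB' : Decays B CB (min (min (min α β) δU / 2) δV) :=
    decays_mono hB hCB le_rfl ((min_le_left _ _).trans ((half_le_self (lt_min hαβ hδU).le).trans ((min_le_left _ _).trans (min_le_right α β))))
  have hV' : BiLoc V p' q' CV (min (min (min α β) δU / 2) δV) := biLoc_mono hV hCV (min_le_right _ _)
  exact (comp_assoc_bdb hP hB' hV' hγ).symm

/-- [folklore] **THE LEG PULLED OUT**: `A ⋆ ((U ⋆ B) ⋆ V) = ((A ⋆ U) ⋆ B) ⋆ V` (two applications of `comp_assoc_bdb`), so the two-leg bubble's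
lattice word IS the tadpole word of the leg `A` against the resolvent-dressed second jet `(U ⋆ B) ⋆ V`. -/
theorem comp_leg_bubbleWord₂_assoc (hA : Decays A CA α) (hα : 0 < α) (hB : Decays B CB β) (hβ : 0 < β)
    (hU : BiLoc U p q CU δU) (hδU : 0 < δU) (hV : BiLoc V p' q' CV δV) (hδV : 0 < δV) :
    ExpKernelCalculus.comp A (ExpKernelCalculus.comp (ExpKernelCalculus.comp U B) V) =
      ExpKernelCalculus.comp (ExpKernelCalculus.comp (ExpKernelCalculus.comp A U) B) V := by
  rcases isEmpty_or_nonempty F with hF | ⟨⟨a₀⟩⟩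
  · funext x z a b; exact (IsEmpty.false a).elim
  have hCA : 0 ≤ CA := hA.nonneg a₀
  have hCB : 0 ≤ CB := hB.nonneg a₀
  have hCU : 0 ≤ CU := hU.nonneg a₀
  have hCV : 0 ≤ CV := hV.nonneg a₀
  have hαβ : 0 < min α β := lt_min hα hβ
  -- common rate for all four kernels
  set γ := min (min (min α β) δU / 2) δV with hγdef
  have hγ : 0 < γ := lt_min (half_pos (lt_min hαβ hδU)) hδV
  have hγU : γ ≤ δU := (min_le_left _ _).trans ((half_le_self (lt_min hαβ hδU).le).trans (min_le_right _ _))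
  have hγβ : γ ≤ β := (min_le_left _ _).trans ((half_le_self (lt_min hαβ hδU).le).trans ((min_le_left _ _).trans (min_le_right α β)))
  have hγα : γ ≤ α := (min_le_left _ _).trans ((half_le_self (lt_min hαβ hδU).le).trans ((min_le_left _ _).trans (min_le_left α β)))
  have hA' : Decays A CA γ := decays_mono hA hCA le_rfl hγα
  have hB' : Decays B CB γ := decays_mono hB hCB le_rfl hγβ
  have hU' : BiLoc U p q CU γ := biLoc_mono hU hCU hγU
  have hV' : BiLoc V p' q' CV γ := biLoc_mono hV hCV (min_le_right _ _)
  -- `(U ⋆ B) ⋆ V = U ⋆ (B ⋆ V)` and `A ⋆ (U ⋆ (B⋆V)) = (A ⋆ U) ⋆ (B ⋆ V)` — all by `comp_assoc_bdb`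
  have hBV : BiLoc (ExpKernelCalculus.comp B V) p' q' ((Fintype.card F : ℝ) * (CB * CV) * ExpKernelCalculus.Zl (d + 1) (γ - γ / 2)) (γ / 2) :=
    ExpKernelCalculus.biLoc_comp_decays hB' hV' (half_pos hγ).le (half_lt_self hγ)
  have h1 : ExpKernelCalculus.comp (ExpKernelCalculus.comp U B) V = ExpKernelCalculus.comp U (ExpKernelCalculus.comp B V) :=
    (comp_assoc_bdb hU' hB' hV' hγ).symm
  rw [h1, comp_bubbleWord₂_assoc hA hα hB hβ hU hδU hV hδV]
  -- `A ⋆ (U ⋆ (B ⋆ V)) = (A ⋆ U) ⋆ (B ⋆ V)`: `comp_assoc_bdb` wants `biloc ∘ decays ∘ biloc`; use it in the form decays-first via the leg word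
  have hU2 : BiLoc U p q CU (γ / 2) := biLoc_mono hU hCU (by linarith)
  have hA2 : Decays A CA (γ / 2) := decays_mono hA hCA le_rfl (by linarith)
  exact comp_assoc_dbb hA2 hU2 hBV (half_pos hγ)

/-- [folklore] **`tendsto_trace_tadpole₂` — THE ORDER-2 TADPOLE OF A TWO-INSERTION JET**: for `Mk`-invariant decaying legs `A`, `B` and bi-localised
`U`, `V`: `trace (perF A · (perF (dper U) · perF B · perF (dper V))) → tadpole A ((U ⋆ B) ⋆ V)` — the lattice value the END's `hessKer`
assigns to a resolvent-dressed second jet `(U⋆B)⋆V` in its tadpole slot. -/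
theorem tendsto_trace_tadpole₂ (Mk : ℕ → (Fin (d + 1) → ℕ)) [∀ k μ, NeZero (Mk k μ)] (hMk : ∀ N : ℕ, ∀ᶠ k in atTop, ∀ i, N ≤ Mk k i)
    (hA : Decays A CA α) (hα : 0 < α) (hB : Decays B CB β) (hβ : 0 < β)
    (hAinv : ∀ k (m x y : Fin (d + 1) → ℤ) (a b : F), A (translate (Mk k) x m) (translate (Mk k) y m) a b = A x y a b)
    (hBinv : ∀ k (m x y : Fin (d + 1) → ℤ) (a b : F), B (translate (Mk k) x m) (translate (Mk k) y m) a b = B x y a b)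
    (hU : BiLoc U p q CU δU) (hδU : 0 < δU) (hV : BiLoc V p' q' CV δV) (hδV : 0 < δV) :
    Tendsto (fun k => Matrix.trace (perF (Mk k) A * (perF (Mk k) (dper (Mk k) U) * perF (Mk k) B * perF (Mk k) (dper (Mk k) V)))) atTop
      (𝓝 (tadpole A (ExpKernelCalculus.comp (ExpKernelCalculus.comp U B) V))) := by
  have h := tendsto_trace_bubble₂ Mk hMk hA hα hB hβ hAinv hBinv hU hδU hV hδV
  rw [← comp_leg_bubbleWord₂_assoc hA hα hB hβ hU hδU hV hδV] at h
  refine h.congr fun k => ?_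
  simp only [Matrix.mul_assoc]

/-- [folklore] **`tendsto_two_mul_hessT_perF₂` — `2·hessT` WITH A TWO-INSERTION TADPOLE SLOT**: `2·hessT L V₁ V₂ W♯ = tr (L·W♯) − tr (L·V₁·(L·V₂))`
with the leg `L = perF A`, first jets `V₁ = perF (dper U)`, `V₂ = perF (dper V)` as in (P2‴), and the second-jet slot the two-insertion word
`W♯ = perF (dper U′) · perF B · perF (dper V′)` ⟹ `→ tadpole A ((U′⋆B)⋆V′) − bubble A U V`. -/
theorem tendsto_two_mul_hessT_perF₂ (Mk : ℕ → (Fin (d + 1) → ℕ)) [∀ k μ, NeZero (Mk k μ)] (hMk : ∀ N : ℕ, ∀ᶠ k in atTop, ∀ i, N ≤ Mk k i)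
    (hA : Decays A CA α) (hα : 0 < α) (hB : Decays B CB β) (hβ : 0 < β)
    (hAinv : ∀ k (m x y : Fin (d + 1) → ℤ) (a b : F), A (translate (Mk k) x m) (translate (Mk k) y m) a b = A x y a b)
    (hBinv : ∀ k (m x y : Fin (d + 1) → ℤ) (a b : F), B (translate (Mk k) x m) (translate (Mk k) y m) a b = B x y a b)
    (hU : BiLoc U p q CU δU) (hδU : 0 < δU) (hV : BiLoc V p' q' CV δV) (hδV : 0 < δV)
    (hU' : BiLoc U' r s CU' δU') (hδU' : 0 < δU') (hV' : BiLoc V' r' s' CV' δV') (hδV' : 0 < δV') :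
    Tendsto (fun k => 2 * hessT (perF (Mk k) A) (perF (Mk k) (dper (Mk k) U)) (perF (Mk k) (dper (Mk k) V))
        (perF (Mk k) (dper (Mk k) U') * perF (Mk k) B * perF (Mk k) (dper (Mk k) V'))) atTop
      (𝓝 (tadpole A (ExpKernelCalculus.comp (ExpKernelCalculus.comp U' B) V') - bubble A U V)) := by
  have ht := tendsto_trace_tadpole₂ Mk hMk hA hα hB hβ hAinv hBinv hU' hδU' hV' hδV'
  have hb := tendsto_trace_bubble' Mk hMk hA hα hAinv hU hδU hV hδV
  refine (ht.sub hb).congr fun k => ?_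
  rw [two_mul_hessT, Matrix.mul_assoc (perF (Mk k) A * perF (Mk k) (dper (Mk k) U))]

end Tadpole2

end Summit.QuantumFields.BalabanUV.Beta.FP.KernelPeriodisationFibTraceTwoLegs

end
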